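import Mathlib
import Summits.NavierStokesRegularity.NavierStokesRegularity.Theorems.FilamentSkeletonRssStadiumSchwarzReflection

/-!
# Route `FilamentSkeletonRss` · twin child cruxes `TangentSkeletonNearStraight` (stmt-28295) / `TangentSkeletonNearStraightL` (stmt-23320) ·
# shared registered stub `stub_stripPropagation : StripPropagation` — brick: GLUING TWO CONTINUATIONS ALONG THE REAL TRACE (left half ∪ right half)

The quarter-width continuation of `τ ↦ u X (X j τ)` is naturally built with a target-dependent contour whose shape depends on WHICH END of the stadium
is near (right-half targets: `Theorems.StadiumCornerLeft/RightNear`; left-half targets: the mirrored contour, `Theorems.StadiumCentreReflection`).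
Rather than one two-case formula, one may continue separately on the two overlapping half-stadia `S₄ ∩ {Re z > cc − δ}` and `S₄ ∩ {Re z < cc + δ}`
and GLUE: two holomorphic functions on overlapping open sets whose intersection is preconnected and contains a real segment on which both equal the
same real datum coincide on the intersection (identity theorem, `eqOn_inter_of_real_agree`), so the piecewise function is holomorphic on the union
(`glue_differentiableOn`), keeps the real agreement and the bound (`glue_stadium_halves`: the output clause of the stub on the quarter stadium from the
two half-stadium clauses).  Values in any complete complex normed space.
HONEST FRAMING: a complex-analysis brick for the bookkeeping of a HYPOTHETICAL filament skeleton on the NEGATIVE side of a MODEL route; no stub of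
28295 / 23320 is closed here; nothing here bears on Navier–Stokes regularity or blow-up.  `--supports stmt-NavierStokesRegularity-28295`.
-/

set_option linter.dupNamespace false

noncomputable section

namespace Summit.NavierStokesRegularity.NavierStokesRegularity.Theorems.StadiumGlue

open Set Filter Topology Complex
open Summit.NavierStokesRegularity.NavierStokesRegularity.Theorems.StadiumSchwarzReflection

variable {E : Type*} [NormedAddCommGroup E] [NormedSpace ℂ E] [CompleteSpace E]

/-! ## §1  Identity theorem across an overlap containing a real segment -/

/-- **Agreement on the overlap.**  `U₁` holomorphic on the open `V₁`, `U₂` on the open `V₂`, `V₁ ∩ V₂` preconnected and containing the real segment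
`[a, b]` (`a < b`) on which `U₁ = U₂`: then `U₁ = U₂` on `V₁ ∩ V₂`. [folklore; identity theorem] -/
theorem eqOn_inter_of_real_agree {V₁ V₂ : Set ℂ} (hV₁ : IsOpen V₁) (hV₂ : IsOpen V₂) (hpre : IsPreconnected (V₁ ∩ V₂))
    {U₁ U₂ : ℂ → E} (hU₁ : DifferentiableOn ℂ U₁ V₁) (hU₂ : DifferentiableOn ℂ U₂ V₂) {a b : ℝ} (hab : a < b)
    (hI : ∀ t : ℝ, t ∈ Icc a b → (t : ℂ) ∈ V₁ ∩ V₂) (hagree : ∀ t : ℝ, t ∈ Icc a b → U₁ t = U₂ t) :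
    EqOn U₁ U₂ (V₁ ∩ V₂) := by
  have hV : IsOpen (V₁ ∩ V₂) := hV₁.inter hV₂
  have hDd : DifferentiableOn ℂ (fun z => U₁ z - U₂ z) (V₁ ∩ V₂) :=
    (hU₁.mono inter_subset_left).sub (hU₂.mono inter_subset_right)
  have hDa : AnalyticOnNhd ℂ (fun z => U₁ z - U₂ z) (V₁ ∩ V₂) := hDd.analyticOnNhd hV
  set t₀ : ℝ := (a + b) / 2 with ht₀def
  have ht₀ : t₀ ∈ Ioo a b := by constructor <;> (rw [ht₀def]; linarith)
  have htend : Tendsto (fun t : ℝ => (t : ℂ)) (𝓝[≠] t₀) (𝓝[≠] ((t₀ : ℝ) : ℂ)) := by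
    refine tendsto_nhdsWithin_of_tendsto_nhds_of_eventually_within _
      (Complex.continuous_ofReal.continuousAt.mono_left nhdsWithin_le_nhds) ?_
    filter_upwards [self_mem_nhdsWithin] with t ht
    simpa using ht
  have hev : ∀ᶠ t : ℝ in 𝓝[≠] t₀, U₁ (t : ℂ) - U₂ (t : ℂ) = 0 := by
    have : ∀ᶠ t : ℝ in 𝓝[≠] t₀, t ∈ Ioo a b := mem_nhdsWithin_of_mem_nhds (Ioo_mem_nhds ht₀.1 ht₀.2)
    exact this.mono fun t ht => sub_eq_zero.mpr (hagree t (Ioo_subset_Icc_self ht))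
  have hfreq : ∃ᶠ z in 𝓝[≠] ((t₀ : ℝ) : ℂ), U₁ z - U₂ z = 0 := htend.frequently hev.frequently
  have hEq := hDa.eqOn_zero_of_preconnected_of_frequently_eq_zero hpre (hI t₀ (Ioo_subset_Icc_self ht₀)) hfreq
  intro z hz
  have h := hEq hz
  simpa [sub_eq_zero] using h

/-! ## §2  The glued function -/

/-- **Gluing.**  Under the hypotheses of `eqOn_inter_of_real_agree` there is ONE function holomorphic on `V₁ ∪ V₂` equal to `U₁` on `V₁` and to
`U₂` on `V₂` (the piecewise function). [folklore] -/
theorem glue_differentiableOn {V₁ V₂ : Set ℂ} (hV₁ : IsOpen V₁) (hV₂ : IsOpen V₂) (hpre : IsPreconnected (V₁ ∩ V₂))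
    {U₁ U₂ : ℂ → E} (hU₁ : DifferentiableOn ℂ U₁ V₁) (hU₂ : DifferentiableOn ℂ U₂ V₂) {a b : ℝ} (hab : a < b)
    (hI : ∀ t : ℝ, t ∈ Icc a b → (t : ℂ) ∈ V₁ ∩ V₂) (hagree : ∀ t : ℝ, t ∈ Icc a b → U₁ t = U₂ t) :
    ∃ U : ℂ → E, DifferentiableOn ℂ U (V₁ ∪ V₂) ∧ (∀ z ∈ V₁, U z = U₁ z) ∧ (∀ z ∈ V₂, U z = U₂ z) := by
  classical
  have hEq := eqOn_inter_of_real_agree hV₁ hV₂ hpre hU₁ hU₂ hab hI hagree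
  set U : ℂ → E := fun z => if z ∈ V₁ then U₁ z else U₂ z with hUdef
  have h1 : ∀ z ∈ V₁, U z = U₁ z := fun z hz => by simp [hUdef, hz]
  have h2 : ∀ z ∈ V₂, U z = U₂ z := by
    intro z hz
    by_cases h : z ∈ V₁
    · rw [h1 z h]; exact hEq ⟨h, hz⟩
    · simp [hUdef, h]
  refine ⟨U, ?_, h1, h2⟩
  intro z hz
  rcases hz with hz | hz
  · have hd : DifferentiableAt ℂ U₁ z := hU₁.differentiableAt (hV₁.mem_nhds hz)
    have hev : U =ᶠ[𝓝 z] U₁ := Filter.eventually_of_mem (hV₁.mem_nhds hz) fun w hw => h1 w hw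
    exact (hev.differentiableAt_iff.mpr hd).differentiableWithinAt
  · have hd : DifferentiableAt ℂ U₂ z := hU₂.differentiableAt (hV₂.mem_nhds hz)
    have hev : U =ᶠ[𝓝 z] U₂ := Filter.eventually_of_mem (hV₂.mem_nhds hz) fun w hw => h2 w hw
    exact (hev.differentiableAt_iff.mpr hd).differentiableWithinAt

/-! ## §3  The quarter stadium from its two halves -/

/-- The two half-stadia: open, their intersection is the (convex) central slab of the stadium, their union is the stadium. [folklore] -/
theorem halves_geometry (h R cc δ : ℝ) (hδ : 0 < δ) :
    IsOpen {z : ℂ | (|z.im| < h ∧ |z.re - cc| < R) ∧ cc - δ < z.re} ∧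
    IsOpen {z : ℂ | (|z.im| < h ∧ |z.re - cc| < R) ∧ z.re < cc + δ} ∧
    IsPreconnected ({z : ℂ | (|z.im| < h ∧ |z.re - cc| < R) ∧ cc - δ < z.re} ∩ {z : ℂ | (|z.im| < h ∧ |z.re - cc| < R) ∧ z.re < cc + δ}) ∧
    ({z : ℂ | (|z.im| < h ∧ |z.re - cc| < R) ∧ cc - δ < z.re} ∪ {z : ℂ | (|z.im| < h ∧ |z.re - cc| < R) ∧ z.re < cc + δ} =
      {z : ℂ | |z.im| < h ∧ |z.re - cc| < R}) := by
  have hS : IsOpen {z : ℂ | |z.im| < h ∧ |z.re - cc| < R} :=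
    (isOpen_lt (continuous_abs.comp Complex.continuous_im) continuous_const).inter
      (isOpen_lt (continuous_abs.comp (Complex.continuous_re.sub continuous_const)) continuous_const)
  have hR : IsOpen {z : ℂ | cc - δ < z.re} := isOpen_lt continuous_const Complex.continuous_re
  have hL : IsOpen {z : ℂ | z.re < cc + δ} := isOpen_lt Complex.continuous_re continuous_const
  refine ⟨hS.inter hR, hS.inter hL, ?_, ?_⟩
  · -- the intersection is the convex set `{|Im| < h, |Re − cc| < R, |Re − cc| < δ}`
    apply Convex.isPreconnected
    have h1 : Convex ℝ {z : ℂ | |z.im| < h ∧ |z.re - cc| < R} := convex_stadium h R cc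
    have h2 : Convex ℝ {z : ℂ | cc - δ < z.re} := by
      have : {z : ℂ | cc - δ < z.re} = Complex.reLm ⁻¹' Set.Ioi (cc - δ) := by ext z; simp
      rw [this]; exact (convex_Ioi _).linear_preimage _
    have h3 : Convex ℝ {z : ℂ | z.re < cc + δ} := by
      have : {z : ℂ | z.re < cc + δ} = Complex.reLm ⁻¹' Set.Iio (cc + δ) := by ext z; simp
      rw [this]; exact (convex_Iio _).linear_preimage _
    have e : ({z : ℂ | (|z.im| < h ∧ |z.re - cc| < R) ∧ cc - δ < z.re} ∩ {z : ℂ | (|z.im| < h ∧ |z.re - cc| < R) ∧ z.re < cc + δ}) =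
        ({z : ℂ | |z.im| < h ∧ |z.re - cc| < R} ∩ {z : ℂ | cc - δ < z.re}) ∩ {z : ℂ | z.re < cc + δ} := by
      ext z; simp only [mem_inter_iff, mem_setOf_eq]; tauto
    rw [e]
    exact (h1.inter h2).inter h3
  · ext z
    simp only [mem_union, mem_setOf_eq]
    constructor
    · rintro (⟨h1, _⟩ | ⟨h1, _⟩) <;> exact h1
    · intro h1
      by_cases hz : cc - δ < z.re
      · exact Or.inl ⟨h1, hz⟩
      · exact Or.inr ⟨h1, by linarith⟩

/-- **The stub's output clause from two half-stadium clauses.**  If `f : ℝ → ℝ³`-type real data (`fr : ℝ → E` its complexification) has a holomorphic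
continuation with bound `B` on the right half-stadium `{Re z > cc − δ}` and one on the left half-stadium `{Re z < cc + δ}` (`0 < δ ≤ R`, `0 < h`), then it
has one on the whole stadium `{|Im z| < h, |Re z − cc| < R}` with the same bound. [folklore] -/
theorem glue_stadium_halves {h R cc δ B : ℝ} (hh : 0 < h) (hδ : 0 < δ) (hδR : δ ≤ R) {fr : ℝ → E}
    (hright : ∃ U : ℂ → E, DifferentiableOn ℂ U {z : ℂ | (|z.im| < h ∧ |z.re - cc| < R) ∧ cc - δ < z.re} ∧
      (∀ t : ℝ, (t : ℂ) ∈ {z : ℂ | (|z.im| < h ∧ |z.re - cc| < R) ∧ cc - δ < z.re} → U t = fr t) ∧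
      ∀ z ∈ {z : ℂ | (|z.im| < h ∧ |z.re - cc| < R) ∧ cc - δ < z.re}, ‖U z‖ ≤ B)
    (hleft : ∃ U : ℂ → E, DifferentiableOn ℂ U {z : ℂ | (|z.im| < h ∧ |z.re - cc| < R) ∧ z.re < cc + δ} ∧
      (∀ t : ℝ, (t : ℂ) ∈ {z : ℂ | (|z.im| < h ∧ |z.re - cc| < R) ∧ z.re < cc + δ} → U t = fr t) ∧
      ∀ z ∈ {z : ℂ | (|z.im| < h ∧ |z.re - cc| < R) ∧ z.re < cc + δ}, ‖U z‖ ≤ B) :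
    ∃ U : ℂ → E, DifferentiableOn ℂ U {z : ℂ | |z.im| < h ∧ |z.re - cc| < R} ∧
      (∀ t : ℝ, (t : ℂ) ∈ {z : ℂ | |z.im| < h ∧ |z.re - cc| < R} → U t = fr t) ∧
      ∀ z ∈ {z : ℂ | |z.im| < h ∧ |z.re - cc| < R}, ‖U z‖ ≤ B := by
  obtain ⟨U₁, hU₁, hU₁r, hU₁B⟩ := hright
  obtain ⟨U₂, hU₂, hU₂r, hU₂B⟩ := hleft
  obtain ⟨hV₁, hV₂, hpre, hunion⟩ := halves_geometry h R cc δ hδ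
  -- the real segment `[cc − δ/2, cc + δ/2]` lies in both halves, and `U₁ = fr = U₂` there
  have hab : cc - δ / 2 < cc + δ / 2 := by linarith
  have hI : ∀ t : ℝ, t ∈ Icc (cc - δ / 2) (cc + δ / 2) →
      (t : ℂ) ∈ {z : ℂ | (|z.im| < h ∧ |z.re - cc| < R) ∧ cc - δ < z.re} ∩ {z : ℂ | (|z.im| < h ∧ |z.re - cc| < R) ∧ z.re < cc + δ} := by
    intro t ht
    have h0 : |(t : ℂ).im| < h := by simpa using hh
    have h1 : |(t : ℂ).re - cc| < R := by
      rw [Complex.ofReal_re, abs_lt]; constructor <;> linarith [ht.1, ht.2]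
    have h2 : cc - δ < (t : ℂ).re := by rw [Complex.ofReal_re]; linarith [ht.1]
    have h3 : (t : ℂ).re < cc + δ := by rw [Complex.ofReal_re]; linarith [ht.2]
    exact ⟨⟨⟨h0, h1⟩, h2⟩, ⟨⟨h0, h1⟩, h3⟩⟩
  have hagree : ∀ t : ℝ, t ∈ Icc (cc - δ / 2) (cc + δ / 2) → U₁ t = U₂ t := fun t ht =>
    (hU₁r t (hI t ht).1).trans (hU₂r t (hI t ht).2).symm
  obtain ⟨U, hU, hUV₁, hUV₂⟩ := glue_differentiableOn hV₁ hV₂ hpre hU₁ hU₂ hab hI hagree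
  refine ⟨U, ?_, ?_, ?_⟩
  · rw [← hunion]; exact hU
  · intro t ht
    have ht' := ht
    rw [← hunion] at ht'
    rcases ht' with h1 | h2
    · rw [hUV₁ _ h1]; exact hU₁r t h1
    · rw [hUV₂ _ h2]; exact hU₂r t h2
  · intro z hz
    have hz' := hz
    rw [← hunion] at hz'
    rcases hz' with h1 | h2
    · rw [hUV₁ _ h1]; exact hU₁B z h1
    · rw [hUV₂ _ h2]; exact hU₂B z h2

end Summit.NavierStokesRegularity.NavierStokesRegularity.Theorems.StadiumGlue
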